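import Mathlib
import Literature.AlgebraicGeometry.Resolution.VertexInitialForms
import HarnessLib

/-!
# `v`-preparedness and preparation at the lower `δ`-vertex `w⁻`

Topic: `Literature/AlgebraicGeometry/Resolution`. Hironaka's vertex preparation, restricted to
what the point blow-up laws need (Cossart–Jannsen–Saito, LNM 2270, Definition 11.2:
`v`-prepared; Lemma 11.4 (1)–(2): "after preparation we may assume `(f, y, u)` is prepared along
the `δ`-face", preparation at vertices other than `v` keeps `β`; Lemma 12.1 (4) needs
preparedness at `w⁻`; Cossart–Piltant 2008, p. 11: "`Δ(E; u₁, u₂; y)` is prepared if no vertex is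
solvable … if a vertex `v` is solvable, change `y` to `y + λ_v u₁^{v₁} u₂^{v₂}`"). We fix
canonical supporting lines: the STEEP line `(βs+1) x₁ + x₂ = (βs+1) αs + βs` through the vertex
`v = (α, β)` and the TILTED `δ`-line `N x₁ + (N+1) x₂ = N δs + γ⁻s`, `N = γ⁻s + 1`, through
`w⁻ = (δ − γ⁻, γ⁻)`; both meet the polygon in one point. PROVED (no facts):

* `VPrepared c J μ` / `WMinusPrepared c J μ` — `v` (resp. `w⁻`) is not solvable along its
  canonical line, for any integral representation and any `λ̄`;
* validity and uniqueness of the canonical lines (`forall_pts_vWeight`, `eq_v_of_vLine`,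
  `forall_pts_wMinusWeight`, `eq_wMinus_of_wMinusLine`);
* `exists_wMinusPrepared` — **preparation at `w⁻` keeping `v`**: if `v` is prepared, finitely
  many dissolutions `y ↦ y + λ u^{w⁻}` produce `c⋆ = (y⋆, u₁, u₂)`, `y⋆ − y ∈ 𝔪²`, with the same
  `α, β`, still `v`-prepared, every half-plane of `c` still valid, `δ` not smaller, and `w⁻`
  prepared (descent on `(α + β − δ, β − γ⁻)`).

## Sources

* V. Cossart, U. Jannsen, S. Saito, LNM 2270 (2020), Def. 11.2, Lemma 11.4, Lemma 12.1 (4),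
  Thm. 8.16. [CossartJannsenSaito2020]
* V. Cossart, O. Piltant, J. Algebra 320 (2008), §4, p. 11–12. [CossartPiltant2008]
-/

noncomputable section

open IsLocalRing MvPolynomial

namespace Literature.AlgebraicGeometry.Resolution

universe u

variable {R : Type u} [CommRing R]

/-! ## Canonical supporting lines -/

section Lines

variable (c : Fin 3 → R) (J : Ideal R) (μ : ℕ)

/-- The steepness `βs + 1` of the canonical line through `v`. [folklore] -/
def steepN : ℕ := betaS c J μ + 1

/-- The level `(βs+1) αs + βs` of the canonical line through `v`. [folklore] -/
def vLevel : ℕ := steepN c J μ * alphaS c J μ + betaS c J μ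

/-- The canonical steep weight through `v = (α, β)`. [cite: CossartJannsenSaito2020, Def. 11.2] -/
def vWeight : Fin 3 → ℕ := levelWeight μ (vLevel c J μ) (steepN c J μ) 1

/-- The tilt `γ⁻s + 1` of the canonical line through `w⁻`. [folklore] -/
def tiltN : ℕ := gammaMinusS c J μ + 1

/-- The level `N δs + γ⁻s` of the canonical line through `w⁻`. [folklore] -/
def wMinusLevel : ℕ := tiltN c J μ * deltaS c J μ + gammaMinusS c J μ

/-- The canonical tilted `δ`-weight through `w⁻ = (δ − γ⁻, γ⁻)`. [cite: CossartJannsenSaito2020, Lemma 12.1 (4)] -/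
def wMinusWeight : Fin 3 → ℕ := levelWeight μ (wMinusLevel c J μ) (tiltN c J μ) (tiltN c J μ + 1)

variable [IsRegularLocalRing R] in
/-- **`v`-preparedness**: the vertex `v` is not solvable along the canonical steep line, for any
integral representation `v = L (v₁, v₂)` and any `λ̄`. [cite: CossartJannsenSaito2020, Def. 11.2]
[cite: CossartPiltant2008, §4 p. 11] -/
def VPrepared (c : Fin 3 → R) (J : Ideal R) (μ : ℕ) : Prop :=
  ∀ (v₁ v₂ : ℕ) (lam : ResidueField R), alphaS c J μ = μ.factorial * v₁ →
    betaS c J μ = μ.factorial * v₂ →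
      ¬ IsSolvableAt c J (vWeight c J μ) (vLevel c J μ * μ) μ (vexp v₁ v₂) lam

variable [IsRegularLocalRing R] in
/-- **Preparedness at `w⁻`**: the vertex `w⁻` is not solvable along the canonical tilted line.
[cite: CossartJannsenSaito2020, Lemma 12.1 (4)] [cite: CossartPiltant2008, §4 p. 11] -/
def WMinusPrepared (c : Fin 3 → R) (J : Ideal R) (μ : ℕ) : Prop :=
  ∀ (v₁ v₂ : ℕ) (lam : ResidueField R), deltaS c J μ = μ.factorial * v₁ + gammaMinusS c J μ →
    gammaMinusS c J μ = μ.factorial * v₂ →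
      ¬ IsSolvableAt c J (wMinusWeight c J μ) (wMinusLevel c J μ * μ) μ (vexp v₁ v₂) lam

variable {c J μ}

/-- **Steep lines support the polygon**: `N αs + βs ≤ N x₁ + x₂` on `pts` for `N ≥ βs + 1`.
[cite: CossartJannsenSaito2020, Def. 11.1] -/
theorem forall_pts_steep {N : ℕ} (hN : betaS c J μ + 1 ≤ N) :
    ∀ e ∈ pts c J μ, N * alphaS c J μ + betaS c J μ ≤ N * spt₁ μ e + 1 * spt₂ μ e := by
  intro e he
  rw [one_mul]
  have hα := alphaS_le he
  rcases hα.eq_or_lt with heq | hlt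
  · have hβ := betaS_le he heq.symm
    rw [heq]; omega
  · have h1 : alphaS c J μ + 1 ≤ spt₁ μ e := hlt
    have := Nat.mul_le_mul_left N h1
    rw [Nat.mul_add, mul_one] at this
    omega

/-- On a steep line through `v`, the only point of the polygon is `v`. [cite: CossartJannsenSaito2020, Def. 11.1] -/
theorem eq_v_of_steep {N : ℕ} (hN : betaS c J μ + 1 ≤ N) {e : Fin 3 →₀ ℕ} (he : e ∈ pts c J μ)
    (h : N * spt₁ μ e + 1 * spt₂ μ e = N * alphaS c J μ + betaS c J μ) :
    spt₁ μ e = alphaS c J μ ∧ spt₂ μ e = betaS c J μ := by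
  rw [one_mul] at h
  have hα := alphaS_le he
  rcases hα.eq_or_lt with heq | hlt
  · have hβ := betaS_le he heq.symm
    rw [← heq] at h
    exact ⟨heq.symm, by omega⟩
  · exfalso
    have h1 : alphaS c J μ + 1 ≤ spt₁ μ e := hlt
    have := Nat.mul_le_mul_left N h1
    rw [Nat.mul_add, mul_one] at this
    omega

/-- The canonical steep line supports the polygon. [cite: CossartJannsenSaito2020, Def. 11.1] -/
theorem forall_pts_vWeight :
    ∀ e ∈ pts c J μ, vLevel c J μ ≤ steepN c J μ * spt₁ μ e + 1 * spt₂ μ e :=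
  forall_pts_steep le_rfl

/-- The canonical steep line meets the polygon only at `v`. [cite: CossartJannsenSaito2020, Def. 11.1] -/
theorem eq_v_of_vLine {e : Fin 3 →₀ ℕ} (he : e ∈ pts c J μ)
    (h : steepN c J μ * spt₁ μ e + 1 * spt₂ μ e = vLevel c J μ) :
    spt₁ μ e = alphaS c J μ ∧ spt₂ μ e = betaS c J μ :=
  eq_v_of_steep le_rfl he h

/-- **Recovering `α, β` from the family of steep lines**: if all steep lines `N x₁ + x₂ ≥ N αs + βs`
(`N ≥ βs + 1`) of `c` are valid on `pts c⋆`, and `pts c⋆` contains a point at `(αs, βs)`, then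
`αs⋆ = αs` and `βs⋆ = βs`. [folklore] -/
theorem alphaS_betaS_eq_of_steep {c' : Fin 3 → R}
    (hS : ∀ N, betaS c J μ + 1 ≤ N → ∀ e ∈ pts c' J μ,
      N * alphaS c J μ + betaS c J μ ≤ N * spt₁ μ e + 1 * spt₂ μ e)
    {ev : Fin 3 →₀ ℕ} (hev : ev ∈ pts c' J μ) (hev1 : spt₁ μ ev = alphaS c J μ)
    (hev2 : spt₂ μ ev = betaS c J μ) :
    alphaS c' J μ = alphaS c J μ ∧ betaS c' J μ = betaS c J μ := by
  have hne' : (pts c' J μ).Nonempty := ⟨ev, hev⟩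
  -- lower bounds on `pts c′`
  have hlow : ∀ x ∈ pts c' J μ, alphaS c J μ ≤ spt₁ μ x ∧
      (spt₁ μ x = alphaS c J μ → betaS c J μ ≤ spt₂ μ x) := by
    intro x hx
    constructor
    · by_contra hlt
      push Not at hlt
      set N := betaS c J μ + spt₂ μ x + 1 with hN
      have h := hS N (by omega) x hx
      rw [one_mul] at h
      have h1 : spt₁ μ x + 1 ≤ alphaS c J μ := hlt
      have := Nat.mul_le_mul_left N h1
      rw [Nat.mul_add, mul_one] at this
      omega
    · intro hx1
      have h := hS (betaS c J μ + 1) le_rfl x hx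
      rw [hx1, one_mul] at h
      omega
  have hα : alphaS c' J μ = alphaS c J μ := by
    refine le_antisymm ?_ ?_
    · rw [← hev1]; exact alphaS_le hev
    · obtain ⟨a, ha, ha1⟩ := exists_pts_alphaS hne'
      rw [← ha1]; exact (hlow a ha).1
  refine ⟨hα, le_antisymm ?_ ?_⟩
  · rw [← hev2]; exact betaS_le hev (by rw [hev1, hα])
  · obtain ⟨b, hb, hb1, hb2⟩ := exists_pts_v hne'
    rw [← hb2]; exact (hlow b hb).2 (by rw [hb1, hα])

/-- The canonical tilted line supports the polygon. [cite: CossartJannsenSaito2020, Lemma 12.1 (4)] -/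
theorem forall_pts_wMinusWeight :
    ∀ e ∈ pts c J μ, wMinusLevel c J μ ≤ tiltN c J μ * spt₁ μ e + (tiltN c J μ + 1) * spt₂ μ e := by
  intro e he
  rw [wMinusLevel, tiltN]
  have hsplit : (gammaMinusS c J μ + 1) * spt₁ μ e + (gammaMinusS c J μ + 1 + 1) * spt₂ μ e =
      (gammaMinusS c J μ + 1) * (spt₁ μ e + spt₂ μ e) + spt₂ μ e := by ring
  rw [hsplit]
  have hδ := deltaS_le he
  rcases hδ.eq_or_lt with heq | hlt
  · have hγ := gammaMinusS_le he heq.symm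
    rw [← heq]; omega
  · have h1 : deltaS c J μ + 1 ≤ spt₁ μ e + spt₂ μ e := hlt
    have := Nat.mul_le_mul_left (gammaMinusS c J μ + 1) h1
    rw [Nat.mul_add, mul_one] at this
    omega

/-- The canonical tilted line meets the polygon only at `w⁻`. [cite: CossartJannsenSaito2020, Lemma 12.1 (4)] -/
theorem eq_wMinus_of_wMinusLine {e : Fin 3 →₀ ℕ} (he : e ∈ pts c J μ)
    (h : tiltN c J μ * spt₁ μ e + (tiltN c J μ + 1) * spt₂ μ e = wMinusLevel c J μ) :
    spt₁ μ e + spt₂ μ e = deltaS c J μ ∧ spt₂ μ e = gammaMinusS c J μ := by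
  rw [wMinusLevel, tiltN] at h
  have hsplit : (gammaMinusS c J μ + 1) * spt₁ μ e + (gammaMinusS c J μ + 1 + 1) * spt₂ μ e =
      (gammaMinusS c J μ + 1) * (spt₁ μ e + spt₂ μ e) + spt₂ μ e := by ring
  rw [hsplit] at h
  have hδ := deltaS_le he
  rcases hδ.eq_or_lt with heq | hlt
  · have hγ := gammaMinusS_le he heq.symm
    rw [← heq] at h
    exact ⟨heq.symm, by omega⟩
  · exfalso
    have h1 : deltaS c J μ + 1 ≤ spt₁ μ e + spt₂ μ e := hlt
    have := Nat.mul_le_mul_left (gammaMinusS c J μ + 1) h1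
    rw [Nat.mul_add, mul_one] at this
    omega

end Lines

/-! ## One dissolution at `w⁻` -/

section Step

variable [IsRegularLocalRing R] (c : Fin 3 → R)
  (hgen : Ideal.span {c 0, c 1, c 2} = maximalIdeal R) (hdim : ringKrullDim R = 3)
  {J : Ideal R} {μ : ℕ} (lam : R) {v₁ v₂ : ℕ}

omit [IsRegularLocalRing R] in
/-- If `w⁻ ≠ v`, then `w⁻` lies strictly beyond every steep line through `v`:
`N αs + βs < N (δs − γ⁻s) + γ⁻s` for `N ≥ βs + 1`. [folklore] -/
theorem steep_lt_of_wMinus_ne (hne : (pts c J μ).Nonempty)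
    (hvw : ¬ (deltaS c J μ = alphaS c J μ + gammaMinusS c J μ ∧ gammaMinusS c J μ = betaS c J μ))
    {N : ℕ} (hN : betaS c J μ + 1 ≤ N) :
    N * alphaS c J μ + betaS c J μ < N * (deltaS c J μ - gammaMinusS c J μ) + gammaMinusS c J μ := by
  obtain ⟨e, he, hsum, h2⟩ := exists_pts_wMinus hne
  have hα := alphaS_le he
  have hγβ : gammaMinusS c J μ ≤ betaS c J μ :=
    (gammaMinusS_le_gammaPlusS hne).trans (gammaPlusS_le_betaS hne)
  have hw1 : deltaS c J μ - gammaMinusS c J μ = spt₁ μ e := by omega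
  rw [hw1]
  rcases hα.eq_or_lt with heq | hlt
  · have hβ := betaS_le he heq.symm
    exfalso; apply hvw
    rw [h2] at hβ
    exact ⟨by omega, le_antisymm hγβ hβ⟩
  · have h1 : alphaS c J μ + 1 ≤ spt₁ μ e := hlt
    have := Nat.mul_le_mul_left N h1
    rw [Nat.mul_add, mul_one] at this
    omega

omit [IsRegularLocalRing R] in
/-- The shift monomial of a vertex with `v₁ + v₂ ≥ 2` lies in `𝔪²`. [folklore] -/
theorem shiftMon_mem_sq [IsLocalRing R] (hgen : Ideal.span {c 0, c 1, c 2} = maximalIdeal R)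
    (hv : 2 ≤ v₁ + v₂) : shiftMon c lam v₁ v₂ ∈ maximalIdeal R ^ 2 := by
  rw [shiftMon]
  refine Ideal.mul_mem_left _ _ ?_
  have hci : ∀ i, c i ∈ maximalIdeal R := fun i => by
    rw [← hgen]; exact Ideal.subset_span (by fin_cases i <;> simp)
  have hmem : c 1 ^ v₁ * c 2 ^ v₂ ∈ maximalIdeal R ^ (v₁ + v₂) := by
    rw [pow_add]
    exact Ideal.mul_mem_mul (Ideal.pow_mem_pow (hci 1) _) (Ideal.pow_mem_pow (hci 2) _)
  exact Ideal.pow_le_pow_right hv hmem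

local notation "c'" => shiftZ c (shiftMon c lam v₁ v₂)

include hgen hdim in
/-- **One dissolution at `w⁻`** (the inductive step): suppose `v` is prepared, `w⁻ = L (v₁, v₂)`
is solvable by the residue of `λ` along the canonical tilted line, and `L < δs`. Then for
`c′ = (y + λ u₁^{v₁} u₂^{v₂}, u)`: `𝔪` is still generated; every steep half-plane of `c` is
valid for `c′` and more generally every positive half-plane; `α, β` are unchanged; `v` stays
prepared; `δ` does not drop; and if `δ` is unchanged then `γ⁻` increases; `y′ − y ∈ 𝔪²`.
[cite: CossartJannsenSaito2020, Lemma 11.4 (1), Thm. 8.16] [cite: CossartPiltant2008, §4 p. 11] -/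
theorem dissolve_wMinus_step (hJne : (pts c J μ).Nonempty) (hδ : μ.factorial < deltaS c J μ)
    (hvprep : VPrepared c J μ)
    (hw1 : deltaS c J μ = μ.factorial * v₁ + gammaMinusS c J μ)
    (hw2 : gammaMinusS c J μ = μ.factorial * v₂)
    (hsolv : IsSolvableAt c J (wMinusWeight c J μ) (wMinusLevel c J μ * μ) μ (vexp v₁ v₂)
      (residue R lam)) :
    Ideal.span {c' 0, c' 1, c' 2} = maximalIdeal R ∧
    (∀ (w₀ p₁ p₂ : ℕ), 0 < w₀ → 0 < p₁ → 0 < p₂ →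
      (∀ e ∈ pts c J μ, w₀ ≤ p₁ * spt₁ μ e + p₂ * spt₂ μ e) →
        ∀ e ∈ pts c' J μ, w₀ ≤ p₁ * spt₁ μ e + p₂ * spt₂ μ e) ∧
    (pts c' J μ).Nonempty ∧ alphaS c' J μ = alphaS c J μ ∧ betaS c' J μ = betaS c J μ ∧
    VPrepared c' J μ ∧ deltaS c J μ ≤ deltaS c' J μ ∧
    (deltaS c' J μ = deltaS c J μ → gammaMinusS c J μ < gammaMinusS c' J μ) ∧
    c' 0 - c 0 ∈ maximalIdeal R ^ 2 := by
  -- the point `e_w` realising `w⁻`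
  obtain ⟨ew, hew, hsum, hew2⟩ := exists_pts_wMinus hJne
  have hew1 : spt₁ μ ew = μ.factorial * v₁ := by omega
  have hew2' : spt₂ μ ew = μ.factorial * v₂ := by omega
  have hv2 : 2 ≤ v₁ + v₂ := by
    by_contra hlt
    push Not at hlt
    have hδ' : deltaS c J μ = μ.factorial * (v₁ + v₂) := by rw [Nat.mul_add]; omega
    have : μ.factorial * (v₁ + v₂) ≤ μ.factorial * 1 := Nat.mul_le_mul_left _ (by omega)
    omega
  have hv : 0 < v₁ + v₂ := by omega
  have hgen' : Ideal.span {c' 0, c' 1, c' 2} = maximalIdeal R := by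
    rw [span_triple_shiftZ c lam hv]; exact hgen
  -- transfer of half-planes
  have htrans : ∀ (w₀ p₁ p₂ : ℕ), 0 < w₀ → 0 < p₁ → 0 < p₂ →
      (∀ e ∈ pts c J μ, w₀ ≤ p₁ * spt₁ μ e + p₂ * spt₂ μ e) →
        ∀ e ∈ pts c' J μ, w₀ ≤ p₁ * spt₁ μ e + p₂ * spt₂ μ e :=
    fun w₀ p₁ p₂ hw₀ hp₁ hp₂ hS =>
      forall_pts_shiftZ_of_forall_pts c hgen hdim lam hv hew hew1 hew2' hw₀ hp₁ hp₂ hS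
  -- `w⁻ ≠ v` since `v` is prepared and `w⁻` is solvable (same-vertex transfer)
  have hvw : ¬ (deltaS c J μ = alphaS c J μ + gammaMinusS c J μ ∧
      gammaMinusS c J μ = betaS c J μ) := by
    rintro ⟨h1, h2⟩
    have hα : alphaS c J μ = μ.factorial * v₁ := by omega
    have hβ : betaS c J μ = μ.factorial * v₂ := by omega
    refine hvprep v₁ v₂ (residue R lam) hα hβ ?_
    have key := isSolvableAt_iff_of_same_vertex c hgen hdim (J := J) (μ := μ)
      (w₀ := vLevel c J μ) (p₁ := steepN c J μ) (p₂ := 1)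
      (q₀ := wMinusLevel c J μ) (q₁ := tiltN c J μ) (q₂ := tiltN c J μ + 1) (v₁ := v₁) (v₂ := v₂)
      (by rw [vLevel, steepN]; nlinarith) (by rw [steepN]; omega) Nat.one_pos
      (by rw [wMinusLevel, tiltN]; nlinarith) (by rw [tiltN]; omega) (by omega)
      (by rw [vLevel, ← hα, ← hβ]; ring) (by rw [wMinusLevel, hw1, hw2]; ring)
      forall_pts_vWeight forall_pts_wMinusWeight
      (fun e he h => by
        obtain ⟨ha, hb⟩ := eq_v_of_vLine he h
        exact ⟨by rw [ha, hα], by rw [hb, hβ]⟩)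
      (fun e he h => by
        obtain ⟨hs, hb⟩ := eq_wMinus_of_wMinusLine he h
        exact ⟨by omega, by omega⟩)
      (residue R lam)
    exact key.mpr hsolv
  -- `v` is preserved
  obtain ⟨ev, hev, hev1, hev2⟩ := exists_pts_v hJne
  have hfarN : ∀ {N : ℕ}, betaS c J μ + 1 ≤ N →
      N * alphaS c J μ + betaS c J μ < μ.factorial * (N * v₁ + 1 * v₂) := by
    intro N hN
    have := steep_lt_of_wMinus_ne c hJne hvw hN
    have hw1' : deltaS c J μ - gammaMinusS c J μ = μ.factorial * v₁ := by omega
    rw [hw1', hw2] at this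
    have hre : μ.factorial * (N * v₁ + 1 * v₂) = N * (μ.factorial * v₁) + μ.factorial * v₂ := by
      ring
    rw [hre]; exact this
  have hpos_v : 0 < steepN c J μ * spt₁ μ ev + 1 * spt₂ μ ev := by
    have := deltaS_le_alphaS_add_betaS hJne
    rw [hev1, hev2, steepN, one_mul]
    nlinarith
  have hmin_v : ∀ x ∈ pts c J μ,
      steepN c J μ * spt₁ μ ev + 1 * spt₂ μ ev ≤ steepN c J μ * spt₁ μ x + 1 * spt₂ μ x := by
    intro x hx
    rw [hev1, hev2]
    have := forall_pts_vWeight x hx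
    rw [vLevel] at this
    omega
  have hev' : ev ∈ pts c' J μ :=
    mem_pts_shiftZ_of_isMinOn c hgen hdim lam (by rw [steepN]; omega) Nat.one_pos hev hmin_v hpos_v
      (by rw [hev1, hev2]; simpa only [one_mul] using hfarN (N := steepN c J μ) le_rfl)
  have hne' : (pts c' J μ).Nonempty := ⟨ev, hev'⟩
  -- `α, β` unchanged
  have hsteep' : ∀ N, betaS c J μ + 1 ≤ N → ∀ e ∈ pts c' J μ,
      N * alphaS c J μ + betaS c J μ ≤ N * spt₁ μ e + 1 * spt₂ μ e := by
    intro N hN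
    have hpos : 0 < N * alphaS c J μ + betaS c J μ := by
      have := deltaS_le_alphaS_add_betaS hJne
      have hN1 : 1 ≤ N := by omega
      have : alphaS c J μ ≤ N * alphaS c J μ := Nat.le_mul_of_pos_left _ hN1
      omega
    exact htrans _ _ _ hpos (by omega) Nat.one_pos (forall_pts_steep hN)
  obtain ⟨hα', hβ'⟩ := alphaS_betaS_eq_of_steep hsteep' hev' hev1 hev2
  -- `v` stays prepared
  have hvW : vWeight c' J μ = vWeight c J μ := by
    simp only [vWeight, vLevel, steepN, hα', hβ']
  have hvL : vLevel c' J μ = vLevel c J μ := by simp only [vLevel, steepN, hα', hβ']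
  have hvprep' : VPrepared c' J μ := by
    intro w₁ w₂ lam' h1 h2
    rw [hvW, hvL]
    rw [hα'] at h1; rw [hβ'] at h2
    have hwpos : ∀ i, 0 < vWeight c J μ i := by
      refine levelWeight_pos ?_ (by rw [steepN]; omega) Nat.one_pos
      have := hpos_v; rw [hev1, hev2] at this; rw [vLevel]; omega
    have hfar : vWeight c J μ 0 + 1 ≤ v₁ * vWeight c J μ 1 + v₂ * vWeight c J μ 2 := by
      simp only [vWeight, levelWeight_zero, levelWeight_one, levelWeight_two]
      have := hfarN (N := steepN c J μ) le_rfl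
      rw [vLevel]
      have hre : v₁ * (μ.factorial * steepN c J μ) + v₂ * (μ.factorial * 1) =
          μ.factorial * (steepN c J μ * v₁ + 1 * v₂) := by ring
      rw [hre]; omega
    have key := isSolvableAt_shiftZ_iff_far c lam hgen hdim hwpos hv hfar (J := J)
      (n := vLevel c J μ * μ) (μ := μ) (v := vexp w₁ w₂) (lam' := lam')
    intro hsol
    exact hvprep w₁ w₂ lam' h1 h2 (key.mp hsol)
  -- `δ` does not drop
  have hδpos : 0 < deltaS c J μ := by omega
  have hδ' : deltaS c J μ ≤ deltaS c' J μ := by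
    obtain ⟨d, hd, hdd⟩ := exists_pts_deltaS hne'
    have := htrans _ 1 1 hδpos Nat.one_pos Nat.one_pos
      (fun e he => by simpa using deltaS_le he) d hd
    rw [← hdd]; simpa using this
  -- if `δ` is unchanged, `γ⁻` increases: the dissolved line carries no point of `pts c′`
  have hγ : deltaS c' J μ = deltaS c J μ → gammaMinusS c J μ < gammaMinusS c' J μ := by
    intro hδeq
    have hline : wMinusLevel c J μ = μ.factorial * (tiltN c J μ * v₁ + (tiltN c J μ + 1) * v₂) := by
      rw [wMinusLevel, hw1, hw2]; ring
    have hlev_pos : 0 < wMinusLevel c J μ := by rw [wMinusLevel, tiltN]; nlinarith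
    have hlt := lt_of_mem_pts_shiftZ_of_isSolvableAt c hgen hdim lam hv hew hew1 hew2' hlev_pos
      (by rw [tiltN]; omega) (by omega) hline forall_pts_wMinusWeight hsolv
    obtain ⟨x, hx, hxsum, hx2⟩ := exists_pts_wMinus hne'
    have h := hlt x hx
    rw [wMinusLevel] at h
    have hsplit : tiltN c J μ * spt₁ μ x + (tiltN c J μ + 1) * spt₂ μ x =
        tiltN c J μ * (spt₁ μ x + spt₂ μ x) + spt₂ μ x := by ring
    rw [hsplit, hxsum, hδeq, hx2] at h
    omega
  refine ⟨hgen', htrans, hne', hα', hβ', hvprep', hδ', hγ, ?_⟩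
  simp only [shiftZ_zero, add_sub_cancel_left]
  exact shiftMon_mem_sq c lam hgen hv2

end Step

/-! ## Iterating: preparation at `w⁻` -/

section Iterate

variable [IsRegularLocalRing R] {J : Ideal R} {μ : ℕ} (hdim : ringKrullDim R = 3)

/-- The descent measure `(αs + βs − δs)(βs + 1) + (βs − γ⁻s)`. [folklore] -/
def wMinusMeasure (c : Fin 3 → R) (J : Ideal R) (μ : ℕ) : ℕ :=
  (alphaS c J μ + betaS c J μ - deltaS c J μ) * (betaS c J μ + 1) + (betaS c J μ - gammaMinusS c J μ)

include hdim in
/-- **Preparation at `w⁻` keeping `v`** (CJS Lemma 11.4 (1)–(2); CoP1 p. 11): if `v` is prepared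
and `δ > 1`, finitely many dissolutions at `w⁻` yield `c⋆ = (y⋆, u₁, u₂)` with `y⋆ − y ∈ 𝔪²`, all
positive half-planes of `c` valid for `c⋆`, the same `α, β`, `v` still prepared, `δ⋆ ≥ δ`, and
`w⁻` prepared. [cite: CossartJannsenSaito2020, Lemma 11.4] [cite: CossartPiltant2008, §4 p. 11] -/
theorem exists_wMinusPrepared : ∀ (n : ℕ) (c : Fin 3 → R),
    Ideal.span {c 0, c 1, c 2} = maximalIdeal R → (pts c J μ).Nonempty →
    μ.factorial < deltaS c J μ → VPrepared c J μ → wMinusMeasure c J μ ≤ n →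
    ∃ cs : Fin 3 → R, cs 1 = c 1 ∧ cs 2 = c 2 ∧ cs 0 - c 0 ∈ maximalIdeal R ^ 2 ∧
      Ideal.span {cs 0, cs 1, cs 2} = maximalIdeal R ∧
      (∀ (w₀ p₁ p₂ : ℕ), 0 < w₀ → 0 < p₁ → 0 < p₂ →
        (∀ e ∈ pts c J μ, w₀ ≤ p₁ * spt₁ μ e + p₂ * spt₂ μ e) →
          ∀ e ∈ pts cs J μ, w₀ ≤ p₁ * spt₁ μ e + p₂ * spt₂ μ e) ∧
      (pts cs J μ).Nonempty ∧ alphaS cs J μ = alphaS c J μ ∧ betaS cs J μ = betaS c J μ ∧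
      VPrepared cs J μ ∧ deltaS c J μ ≤ deltaS cs J μ ∧ WMinusPrepared cs J μ := by
  intro n
  induction n with
  | zero =>
    intro c hgen hne hδ hvprep hM
    by_cases hprep : WMinusPrepared c J μ
    · exact ⟨c, rfl, rfl, by simp, hgen, fun _ _ _ _ _ _ hS => hS, hne, rfl, rfl, hvprep, le_rfl, hprep⟩
    · exfalso
      obtain ⟨v₁, v₂, lam', h1, h2, hsol⟩ : ∃ v₁ v₂ lam', deltaS c J μ = μ.factorial * v₁ + gammaMinusS c J μ ∧
          gammaMinusS c J μ = μ.factorial * v₂ ∧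
          IsSolvableAt c J (wMinusWeight c J μ) (wMinusLevel c J μ * μ) μ (vexp v₁ v₂) lam' := by
        simpa [WMinusPrepared] using hprep
      obtain ⟨lam, rfl⟩ := residue_surjective (R := R) lam'
      obtain ⟨-, -, hne', hα', hβ', -, hδ', hγ, -⟩ :=
        dissolve_wMinus_step c hgen hdim lam hne hδ hvprep h1 h2 hsol
      -- the measure would drop below `0`
      have hM0 : wMinusMeasure c J μ = 0 := by omega
      rw [wMinusMeasure] at hM0
      have hγβ : gammaMinusS c J μ ≤ betaS c J μ :=
        (gammaMinusS_le_gammaPlusS hne).trans (gammaPlusS_le_betaS hne)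
      have hdab := deltaS_le_alphaS_add_betaS hne
      have hdab' := deltaS_le_alphaS_add_betaS hne'
      rw [hα', hβ'] at hdab'
      have hγβ' : gammaMinusS (shiftZ c (shiftMon c lam v₁ v₂)) J μ ≤
          betaS (shiftZ c (shiftMon c lam v₁ v₂)) J μ :=
        (gammaMinusS_le_gammaPlusS hne').trans (gammaPlusS_le_betaS hne')
      rw [hβ'] at hγβ'
      have h0 : (alphaS c J μ + betaS c J μ - deltaS c J μ) * (betaS c J μ + 1) = 0 := by omega
      rcases Nat.mul_eq_zero.mp h0 with h0' | h0'
      · -- `δs = αs + βs` for `c`, hence also for `c′`; then `γ⁻` increases but `γ⁻ = βs` already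
        have : deltaS c J μ = alphaS c J μ + betaS c J μ := by omega
        have hδeq : deltaS (shiftZ c (shiftMon c lam v₁ v₂)) J μ = deltaS c J μ := by omega
        have := hγ hδeq
        omega
      · omega
  | succ n ih =>
    intro c hgen hne hδ hvprep hM
    by_cases hprep : WMinusPrepared c J μ
    · exact ⟨c, rfl, rfl, by simp, hgen, fun _ _ _ _ _ _ hS => hS, hne, rfl, rfl, hvprep, le_rfl, hprep⟩
    · obtain ⟨v₁, v₂, lam', h1, h2, hsol⟩ : ∃ v₁ v₂ lam', deltaS c J μ = μ.factorial * v₁ + gammaMinusS c J μ ∧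
          gammaMinusS c J μ = μ.factorial * v₂ ∧
          IsSolvableAt c J (wMinusWeight c J μ) (wMinusLevel c J μ * μ) μ (vexp v₁ v₂) lam' := by
        simpa [WMinusPrepared] using hprep
      obtain ⟨lam, rfl⟩ := residue_surjective (R := R) lam'
      obtain ⟨hgen', htrans, hne', hα', hβ', hvprep', hδ', hγ, hsq⟩ :=
        dissolve_wMinus_step c hgen hdim lam hne hδ hvprep h1 h2 hsol
      -- the measure drops
      have hM' : wMinusMeasure (shiftZ c (shiftMon c lam v₁ v₂)) J μ ≤ n := by
        have hγβ : gammaMinusS c J μ ≤ betaS c J μ :=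
          (gammaMinusS_le_gammaPlusS hne).trans (gammaPlusS_le_betaS hne)
        have hγβ' : gammaMinusS (shiftZ c (shiftMon c lam v₁ v₂)) J μ ≤ betaS c J μ := by
          rw [← hβ']
          exact (gammaMinusS_le_gammaPlusS hne').trans (gammaPlusS_le_betaS hne')
        have hdab := deltaS_le_alphaS_add_betaS hne
        have hdab' := deltaS_le_alphaS_add_betaS hne'
        rw [hα', hβ'] at hdab'
        rw [wMinusMeasure] at hM ⊢
        rw [hα', hβ']
        rcases hδ'.eq_or_lt with hδeq | hδlt
        · have := hγ hδeq.symm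
          rw [← hδeq]
          omega
        · -- first factor drops by at least one multiple of `βs + 1`
          have h3 : alphaS c J μ + betaS c J μ - deltaS (shiftZ c (shiftMon c lam v₁ v₂)) J μ + 1 ≤
              alphaS c J μ + betaS c J μ - deltaS c J μ := by omega
          have h4 := Nat.mul_le_mul_right (betaS c J μ + 1) h3
          rw [Nat.add_mul, one_mul] at h4
          omega
      obtain ⟨cs, hcs1, hcs2, hcs0, hgens, htranss, hnes, hαs, hβs, hvpreps, hδs, hpreps⟩ :=
        ih _ hgen' hne' (lt_of_lt_of_le hδ hδ') hvprep' hM'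
      refine ⟨cs, by rw [hcs1]; rfl, by rw [hcs2]; rfl, ?_, hgens, ?_, hnes, by rw [hαs, hα'],
        by rw [hβs, hβ'], hvpreps, hδ'.trans hδs, hpreps⟩
      · have : cs 0 - c 0 = (cs 0 - shiftZ c (shiftMon c lam v₁ v₂) 0) +
            (shiftZ c (shiftMon c lam v₁ v₂) 0 - c 0) := by ring
        rw [this]; exact Ideal.add_mem _ hcs0 hsq
      · intro w₀ p₁ p₂ hw₀ hp₁ hp₂ hS
        exact htranss w₀ p₁ p₂ hw₀ hp₁ hp₂ (htrans w₀ p₁ p₂ hw₀ hp₁ hp₂ hS)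

end Iterate

end Literature.AlgebraicGeometry.Resolution
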